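import Literature.AlgebraicGeometry.Resolution.ZariskiProjectiveBundle
import Literature.AlgebraicTopology.CharacteristicClasses.ProjectiveBundleTrivialisedLerayHirsch
import Literature.AlgebraicGeometry.HodgeTheory.ZariskiProjectiveBundleComplexPoints
import Literature.AlgebraicGeometry.Motives.FlatSubfamilyProofs
import Literature.AlgebraicGeometry.HodgeTheory.AlgebraicClassesPullback
import Literature.AlgebraicGeometry.HodgeTheory.AlgebraicCyclesDefinedOverQbar
import Literature.AlgebraicGeometry.HodgeTheory.ComplexGysinSurjective
import Literature.AlgebraicGeometry.HodgeTheory.WeilClassesFourfoldsProofs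
import Literature.AlgebraicTopology.CharacteristicClasses.ProjectiveSpaceLerayHirsch
import Literature.AlgebraicTopology.SingularHomology.CohomologyVanishingNearUnion
import Literature.AlgebraicTopology.SingularHomology.LerayHirschGlobal
import HarnessLib

/-!
# Leray–Hirsch for a Zariski-locally trivial `ℙʳ`-bundle of smooth projective complex varieties

Topic `Literature/AlgebraicGeometry/HodgeTheory`. PROVED over the tree, no named fact.

Let `q : E ⟶ X` be a `ℂ`-morphism of `ℂ`-schemes, `X` smooth projective of dimension `n`, which is a
Zariski `ℙʳ`-bundle (`Resolution.IsZariskiProjectiveBundle r q`: Zariski-locally over `X`, isomorphic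
over `X` to the projection `U ⊗ ℙʳ_ℂ → U`), and let `ζ ∈ H²(E(ℂ); ℂ)` restrict non-trivially along every
closed immersion `ℙʳ ⟶ E` (for `r ≥ 1`). Then:

* `exists_isOpen_isLH` — every point of `X(ℂ)` has an open neighbourhood `P` such that the Leray–Hirsch
  comparison map of `q(ℂ)⁻¹W → W` with the classes `ζʲ|`, `j ≤ r`, is bijective for every `W ⊆ P`;
* `bijective_lhMap` — **the Leray–Hirsch theorem for `q(ℂ)`**: `(a_j)_{j ≤ r} ↦ Σⱼ q^* a_j ∪ ζʲ` is a
  bijection `Π_{2j ≤ k} Hᵏ⁻²ʲ(X(ℂ); ℂ) → Hᵏ(E(ℂ); ℂ)` for every `k`;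
* `exists_expansion` — every `y ∈ H²ᵖ(E(ℂ); ℂ)` is `Σ_{b ≤ min r p} ζᵇ ∪ q^* x_b` with
  `x_b ∈ H²ᵖ⁻²ᵇ(X(ℂ); ℂ)`.

Proof (D. Husemoller, *Fibre Bundles*, Ch. 17 §1 Thm. 1.1 and §2 Thm. 2.5; A. Hatcher, *Algebraic
Topology*, Thm. 4D.1; C. Voisin, *Hodge Theory I*, Lemma 7.32). On complex points `q(ℂ)` is, over the
open `U(ℂ)` of each trivialising `U`, homeomorphic over `U(ℂ)` to `U(ℂ) × ℙ(ℂ^{r+1}) → U(ℂ)`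
(`ZariskiProjectiveBundle.exists_trivialisation`). Over a CONTRACTIBLE open `P ⊆ U(ℂ)` (small chart
balls, which cover) the transported class `ζ` is `c • pr₂^* x` with `c ≠ 0` (`x` the tautological class
of `ℙ(ℂ^{r+1})`; the degree-`2` case of the product Leray–Hirsch theorem; `c ≠ 0` by the fibre
restriction), so its powers are a rescaled Leray–Hirsch basis over every open `W ⊆ P`
(`isLH_of_trivialisation`, from the tree's `projectiveSpace_lerayHirsch`), and the tree's local-to-global
theorem `LerayHirsch.bijective_of_cover` over the compact Hausdorff `X(ℂ)` gives `bijective_lhMap`;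
`exists_expansion` is its surjectivity (graded commutativity in even degrees to write `ζᵇ ∪ q^* x_b`).

Provenance: this is the Literature home of §Main of
`Summits/HodgeConjecture/HodgeConjecture/Theorems/BoundaryReadoutPullbackAlgebraicBundleLerayHirsch.lean`
(route `BoundaryReadout`, crux `PullbackAlgebraic`, stub `stub_bundleLerayHirsch`; prover seats of that
route), restated on the Literature predicate `Resolution.IsZariskiProjectiveBundle` (p520951) so that
Literature files (the Hodge conjecture for projective bundles and for smooth blow-ups,
`ProjectiveBundleHodgeConjecture`, `HodgeClassesBlowupHolds`) can import it.

## References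

* [HusemollerFibreBundles1994] D. Husemoller, Fibre Bundles, 3rd ed., GTM 20, Springer 1994,
  Ch. 17 §1 Thm. 1.1, §2 Thm. 2.5.
* [HatcherAT2002] A. Hatcher, Algebraic Topology, CUP 2002, §3.2 Thm. 3.16, §4.D Thm. 4D.1.
* [VoisinHodgeI2002] C. Voisin, Hodge Theory and Complex Algebraic Geometry I, CUP 2002, §3.3.2,
  §7.3.3 Lemma 7.32.
-/

noncomputable section

open CategoryTheory AlgebraicGeometry MonoidalCategory CartesianMonoidalCategory
  Literature.AlgebraicGeometry Literature.AlgebraicGeometry.Motives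
  Literature.AlgebraicGeometry.HodgeTheory Literature.AlgebraicGeometry.Resolution
open Literature.AlgebraicTopology.SingularHomology (cupProduct)

namespace Literature.AlgebraicGeometry.HodgeTheory

namespace ZariskiProjectiveBundle


open Function Set Literature.AlgebraicTopology.SingularHomology
  Literature.AlgebraicTopology.SingularHomology.LerayHirsch
  Literature.AlgebraicTopology.CharacteristicClasses Literature.NumberTheory.Transcendental
open scoped LinearAlgebra.Projectivization _root_.Topology

section Main

variable {n r : ℕ} {X E : SchemeOver ℂ} (q : E ⟶ X) (hX : IsSmoothProjective n X)
  (htriv : IsZariskiProjectiveBundle r q)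
  (ζ : complexBetti E 2)
  (hζ : 1 ≤ r → ∀ ι : Motives.projectiveSpace r ℂ ⟶ E, IsClosedImmersion ι.left → complexBetti.map ι 2 ζ ≠ 0)

/-- `LH(ℂ^{r+1}, r + 1)`: the product Leray–Hirsch theorem for `ℙ(ℂ^{r+1})` (the tree's
`projectiveSpace_lerayHirsch`). [cite: HusemollerFibreBundles1994, Ch. 17 §2 Thm. 2.5] -/
theorem isProjLH_fin (r : ℕ) : IsProjLH ℂ (Fin (r + 1) → ℂ) (r + 1) :=
  projectiveSpace_lerayHirsch ℂ r (Fin (r + 1) → ℂ) (Module.finrank_fin_fun ℂ)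

include hX htriv hζ in
/-- **The hereditary local Leray–Hirsch input around every point of `X(ℂ)`**: every `b ∈ X(ℂ)` has
an open neighbourhood `P` (a contractible chart ball inside `U(ℂ)`, `U ∋ b` trivialising) such that
the comparison map of `q(ℂ)⁻¹W → W` with the classes `ζʲ|`, `j ≤ r`, is bijective for every `W ⊆ P`:
over `P` the bundle is `P × ℙ(ℂ^{r+1})` and `ζ|` is `c • pr₂^* x` with `c ≠ 0` (fibre restriction
non-zero). [cite: HusemollerFibreBundles1994, Ch. 17 §1 Thm. 1.1 and §2 Thm. 2.5 (proof)]
[cite: VoisinHodgeI2002, §7.3.3 Lemma 7.32] -/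
theorem exists_isOpen_isLH (b : ComplexPoints X) :
    ∃ P : Set (ComplexPoints X), IsOpen P ∧ b ∈ P ∧ ∀ W ⊆ P,
      IsLH ℂ (evenDeg (r + 1)) (AlgPoints.mapContinuous (L := ℂ) q) (fun j ↦ cupPow ℂ ζ j) W := by
  letI := hX.chartedSpace
  haveI := hX.smoothOfRelativeDimension
  haveI : LocallyOfFiniteType X.hom := by
    haveI : Smooth X.hom := SmoothOfRelativeDimension.smooth n _
    infer_instance
  obtain ⟨U, hbU, φ, hφ⟩ := htriv b.pt
  have hUBo : IsOpen {P : ComplexPoints X | P.pt ∈ U} := AlgPoints.isOpen_setOf_pt_mem U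
  obtain ⟨P, hPo, hbP, hPU, hPc⟩ :=
    exists_isOpen_contractibleSpace_subset (d := 2 * n) b {P : ComplexPoints X | P.pt ∈ U} (hUBo.mem_nhds hbU)
  haveI := hPc
  -- the trivialisation over `U(ℂ)`, restricted over `P`
  set pm : C(ComplexPoints E, ComplexPoints X) := AlgPoints.mapContinuous (L := ℂ) q with hpm
  set V : Type := Fin (r + 1) → ℂ with hV
  have hLH : IsProjLH ℂ V (r + 1) := isProjLH_fin r
  obtain ⟨T, hT, η, hfib⟩ := ZariskiProjectiveBundle.exists_trivialisation φ hφ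
  obtain ⟨TP, hTP, hTPsymm⟩ := exists_trivRestrict pm hPU T hT
  -- the scalar `c` and the transported classes
  obtain ⟨c, hc, hcls⟩ : ∃ c : ℂ, c ≠ 0 ∧ ∀ j : Fin (r + 1),
      singularCohomology.map ℂ ℂ (TP.symm : C(↥P × ℙ ℂ V, ↥(pm ⁻¹' P))) (evenDeg (r + 1) j)
        (resCls pm P (fun j ↦ cupPow ℂ ζ j) j) = c ^ (j : ℕ) • projCls ℂ V ↥P (r + 1) j := by
    rcases Nat.eq_zero_or_pos r with hr | hr
    · -- `r = 0`: only the class `ζ⁰ = 1`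
      subst hr
      refine ⟨1, one_ne_zero, fun j ↦ ?_⟩
      obtain ⟨j, hj⟩ := j
      obtain rfl : j = 0 := by omega
      rw [one_pow, one_smul]
      have e1 : ∀ {A A' : Type} [TopologicalSpace A] [TopologicalSpace A'] (f : C(A, A')),
          singularCohomology.map ℂ ℂ f (2 * 0) (singularCohomology.one ℂ A') = singularCohomology.one ℂ A :=
        fun f ↦ singularCohomology.map_one f
      change singularCohomology.map ℂ ℂ (TP.symm : C(↥P × ℙ ℂ V, ↥(pm ⁻¹' P))) (2 * 0)
        (singularCohomology.map ℂ ℂ (subsetIncl (pm ⁻¹' P)) (2 * 0) (cupPow ℂ ζ 0)) =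
        singularCohomology.map ℂ ℂ (ContinuousMap.snd : C(↥P × ℙ ℂ V, ℙ ℂ V)) (2 * 0) (cupPow ℂ (tautEuler V ℂ 1) 0)
      rw [cupPow_zero, cupPow_zero, e1, e1, e1]
    · -- `r ≥ 1`: `ζ|` is `c • pr₂^* x` over the contractible `P`, `c ≠ 0` by the fibre restriction
      have hP2 : Subsingleton (singularCohomology ℂ ℂ ↥P 2) :=
        ModuleCat.subsingleton_of_isZero (singularCohomology.isZero_of_contractibleSpace ℂ ↥P two_ne_zero)
      set y : singularCohomology ℂ ℂ (↥P × ℙ ℂ V) 2 :=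
        singularCohomology.map ℂ ℂ (TP.symm : C(↥P × ℙ ℂ V, ↥(pm ⁻¹' P))) 2
          (singularCohomology.map ℂ ℂ (subsetIncl (pm ⁻¹' P)) 2 ζ) with hydef
      have hP0 : ∀ z : singularCohomology ℂ ℂ ↥P 0, ∃ c : ℂ, z = c • singularCohomology.one ℂ ↥P :=
        fun z ↦ ⟨_, Literature.AlgebraicGeometry.HodgeTheory.eq_smul_one_of_pathConnectedSpace z⟩
      obtain ⟨c, hy⟩ := exists_eq_smul_map_snd_tautEuler V hLH hr ↥P hP0 hP2 y
      have hc : c ≠ 0 := by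
        intro h0
        -- the slice `v ↦ (b, v)` of `P × ℙ(V)` is a closed fibre embedding `ℙʳ ⟶ E` on complex points
        obtain ⟨ιb, hιb, hιv⟩ := hfib ⟨b, hPU hbP⟩
        let sl : C(ℙ ℂ V, ↥P × ℙ ℂ V) := ⟨fun v ↦ (⟨b, hbP⟩, v), continuous_const.prodMk continuous_id⟩
        have h1 : singularCohomology.map ℂ ℂ sl 2 y = 0 := by
          rw [hy, h0, zero_smul, map_zero]
        have hcomp : (subsetIncl (pm ⁻¹' P)).comp ((TP.symm : C(↥P × ℙ ℂ V, ↥(pm ⁻¹' P))).comp sl) =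
            (AlgPoints.mapContinuous (L := ℂ) ιb).comp (η : C(ℙ ℂ V, ComplexPoints (Motives.projectiveSpace r ℂ))) := by
          ext1 v
          change ((TP.symm (⟨b, hbP⟩, v) : ↥(pm ⁻¹' P)) : ComplexPoints E) = AlgPoints.map ιb (η v)
          rw [hTPsymm]
          exact hιv v
        have h2 : singularCohomology.map ℂ ℂ sl 2 y =
            singularCohomology.map ℂ ℂ (η : C(ℙ ℂ V, ComplexPoints (Motives.projectiveSpace r ℂ))) 2
              (complexBetti.map ιb 2 ζ) := by
          rw [hydef, ← ModuleCat.comp_apply, ← ModuleCat.comp_apply, ← singularCohomology.map_comp,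
            ← singularCohomology.map_comp, hcomp, singularCohomology.map_comp, ModuleCat.comp_apply]
        rw [h2] at h1
        exact hζ hr ιb hιb ((LinearEquiv.map_eq_zero_iff
          (singularCohomology.mapIso ℂ ℂ η 2).toLinearEquiv).mp h1)
      refine ⟨c, hc, fun j ↦ ?_⟩
      change singularCohomology.map ℂ ℂ (TP.symm : C(↥P × ℙ ℂ V, ↥(pm ⁻¹' P))) (2 * (j : ℕ))
        (singularCohomology.map ℂ ℂ (subsetIncl (pm ⁻¹' P)) (2 * (j : ℕ)) (cupPow ℂ ζ j)) =
        c ^ (j : ℕ) • singularCohomology.map ℂ ℂ (ContinuousMap.snd : C(↥P × ℙ ℂ V, ℙ ℂ V)) (2 * (j : ℕ))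
          (cupPow ℂ (tautEuler V ℂ 1) j)
      rw [map_cupPow, map_cupPow, map_cupPow, ← cupPow_smul, ← hy]
  exact ⟨P, hPo, hbP, fun W hWP ↦ isLH_of_trivialisation pm V hLH (fun j ↦ cupPow ℂ ζ j) TP hTP hc hcls hWP⟩

include hX htriv hζ in
/-- **The Leray–Hirsch theorem for `q(ℂ)`**: `(a_j)_{j ≤ r} ↦ Σⱼ q^* a_j ∪ ζʲ` is a bijection
`Π_{2j ≤ k} Hᵏ⁻²ʲ(X(ℂ); ℂ) → Hᵏ(E(ℂ); ℂ)` for every `k` (the tree's local-to-global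
`LerayHirsch.bijective_of_cover` over the compact Hausdorff `X(ℂ)`, fed with `exists_isOpen_isLH`).
[cite: HusemollerFibreBundles1994, Ch. 17 §1 Thm. 1.1, §2 Thm. 2.5] [cite: HatcherAT2002, §4.D Thm. 4D.1] -/
theorem bijective_lhMap (k : ℕ) :
    Bijective (lhMap ℂ (evenDeg (r + 1)) (AlgPoints.mapContinuous (L := ℂ) q) (fun j ↦ cupPow ℂ ζ j) k) := by
  haveI := ComplexPoints.t2Space_of_isSmoothProjective hX
  haveI := ComplexPoints.compactSpace_of_isSmoothProjective hX
  choose P hPo hbP hLH using exists_isOpen_isLH q hX htriv ζ hζ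
  exact bijective_of_cover ℂ (evenDeg (r + 1)) _ _ P hPo
    (eq_univ_of_forall fun b ↦ mem_iUnion.2 ⟨b, hbP b⟩) (fun b W _ hWP ↦ hLH b W hWP) k

include hX htriv hζ in
/-- **(ii) The Leray–Hirsch expansion** `y = Σ_{b ≤ min r p} ζᵇ ∪ q^* x_b` of every
`y ∈ H²ᵖ(E(ℂ); ℂ)` (surjectivity of `bijective_lhMap` in degree `2p`; the summands with `j > p` are
absent, and `q^* a ∪ ζᵇ = ζᵇ ∪ q^* a` in even degrees). [cite: VoisinHodgeI2002, §7.3.3 Lemma 7.32]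
[cite: HatcherAT2002, §4.D Thm. 4D.1 and Thm. 3.11] -/
theorem exists_expansion (p : ℕ) (y : complexBetti E (2 * p)) :
    ∃ x : (b : Fin (min r p + 1)) → complexBetti X (2 * (p - (b : ℕ))),
      y = ∑ b : Fin (min r p + 1),
        cupProduct (show 2 * (b : ℕ) + 2 * (p - (b : ℕ)) = 2 * p by omega) (cupPow ℂ ζ b)
          (complexBetti.map q (2 * (p - (b : ℕ))) (x b)) := by
  obtain ⟨a, ha⟩ := (bijective_lhMap q hX htriv ζ hζ (2 * p)).2 y
  have hmin : min r p + 1 ≤ r + 1 := by omega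
  let ι : Fin (min r p + 1) ↪ Fin (r + 1) := Fin.castLEEmb hmin
  have hιle : ∀ b : Fin (min r p + 1), evenDeg (r + 1) (ι b) ≤ 2 * p := fun b ↦ by
    change 2 * (b : ℕ) ≤ 2 * p
    omega
  have e : ∀ b : Fin (min r p + 1), 2 * p - evenDeg (r + 1) (ι b) = 2 * (p - (b : ℕ)) := fun b ↦ by
    change 2 * p - 2 * (b : ℕ) = 2 * (p - (b : ℕ))
    omega
  have h' : ∀ b : Fin (min r p + 1), 2 * (b : ℕ) + (2 * p - evenDeg (r + 1) (ι b)) = 2 * p := fun b ↦ by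
    change 2 * (b : ℕ) + (2 * p - 2 * (b : ℕ)) = 2 * p
    omega
  refine ⟨fun b ↦ degCast ℂ (e b) (a ⟨ι b, hιle b⟩), ?_⟩
  -- the summands of `θ(a)`
  set G : Fin (r + 1) → complexBetti E (2 * p) := fun j ↦
    if h : evenDeg (r + 1) j ≤ 2 * p then
      cupProduct (Nat.sub_add_cancel h)
        (singularCohomology.map ℂ ℂ (AlgPoints.mapContinuous (L := ℂ) q) (2 * p - evenDeg (r + 1) j) (a ⟨j, h⟩))
        (cupPow ℂ ζ j)
    else 0 with hG
  have hlh : lhMap ℂ (evenDeg (r + 1)) (AlgPoints.mapContinuous (L := ℂ) q) (fun j ↦ cupPow ℂ ζ j) (2 * p) a =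
      ∑ j, G j := lhMap_apply _ _ _ _ _ _
  -- each summand of the statement is `G (ι b)` (graded commutativity in even degrees)
  have hterm : ∀ b : Fin (min r p + 1),
      cupProduct (show 2 * (b : ℕ) + 2 * (p - (b : ℕ)) = 2 * p by omega) (cupPow ℂ ζ b)
        (complexBetti.map q (2 * (p - (b : ℕ))) (degCast ℂ (e b) (a ⟨ι b, hιle b⟩))) = G (ι b) := by
    intro b
    rw [hG]
    dsimp only
    rw [dif_pos (hιle b), map_degCast, cupProduct_degCast_right ℂ (e b) _ (h' b),
      cupProduct_gradedComm_holds ℂ _ (Nat.sub_add_cancel (hιle b)) (h' b),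
      Even.neg_one_pow (Even.mul_left (even_two_mul _) _), one_smul]
    rfl
  rw [← ha, hlh]
  symm
  calc ∑ b : Fin (min r p + 1), cupProduct (show 2 * (b : ℕ) + 2 * (p - (b : ℕ)) = 2 * p by omega)
        (cupPow ℂ ζ b) (complexBetti.map q (2 * (p - (b : ℕ))) (degCast ℂ (e b) (a ⟨ι b, hιle b⟩)))
      = ∑ b : Fin (min r p + 1), G (ι b) := Finset.sum_congr rfl fun b _ ↦ hterm b
    _ = ∑ j ∈ (Finset.univ : Finset (Fin (min r p + 1))).map ι, G j := (Finset.sum_map _ ι G).symm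
    _ = ∑ j, G j := by
      refine Finset.sum_subset (Finset.subset_univ _) fun j _ hj ↦ ?_
      rw [hG]
      dsimp only
      rw [dif_neg]
      intro h
      apply hj
      have hjp : (j : ℕ) ≤ min r p := by
        change 2 * (j : ℕ) ≤ 2 * p at h
        have := j.2
        omega
      exact Finset.mem_map.2 ⟨⟨j, by omega⟩, Finset.mem_univ _, Fin.ext rfl⟩

end Main

end ZariskiProjectiveBundle

end Literature.AlgebraicGeometry.HodgeTheory

end
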